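import Summits.AtomisticToContinuum.FouriersLaw.Theorems.OddSectorIrreversibilityOddCorrectorDecayGibbsMoments
import Summits.AtomisticToContinuum.FouriersLaw.Theorems.OddSectorIrreversibilityOddCorrectorDecayCurrentVarianceD
import HarnessLib

/-!
# Uniform `L²(μ_T)` bound on the two halves of the bond current
(helper `helper_gibbsHalfCurrentSqLe` for stub `stub_flipConductanceCeiling` of line `sector-dirichlet-gluing`,
crux `VanishingNoiseTransfer.NoisyFourier`, item stmt-AtomisticToContinuum-11977)

For the pinned anharmonic chain `P = pinnedChain ω₂ lam β γ` (`ω₂ > 0`, `lam, β ≥ 0`) and its Gibbs probability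
measure `μ_T = P.gibbsMeasure L T` (`T > 0`), the two halves `p_i V'(q_j - q_i)` and `p_j V'(q_j - q_i)` of the
bond current `j_i = -½ (p_i + p_j) V'(q_j - q_i)` (`j = i + 1`, `V'(r) = r + β r³`) are in `L²(μ_T)`, with second
moments bounded by a constant `M(ω₂, lam, β, T)` INDEPENDENT of the length `L` and of the bond (in fact of the
three sites `k, i, j` in `p_k V'(q_j - q_i)`).

Route: the pointwise polynomial bound `(p V'(r))² ≤ 2 p⁴ + r⁴ + β⁴ r¹²` (`sq_mul_deriv_V_le`) and
`(a - b)^{2m} ≤ 2^{2m-1} (a^{2m} + b^{2m})` (`sub_pow_even_le`) dominate the squared half current by one-site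
monomials (`half_current_sq_le`); the tree's `N`-uniform one-site Gibbs moments
(`ChainVariation.pinnedChain_integral_momentum_even_pow_le`: `∫ p_k⁴ e^{-H/T} ≤ 4! T² Z`;
`ChainVariation.pinnedChain_integral_coord_pow_mul_gibbsDensity_le`: `∫ q_k^{2m} e^{-H/T} ≤ κ_{2m} Z`) bound
their weighted integrals (`exists_integral_half_current_sq_mul_gibbsDensity_le`), and the Gibbs weight
`e^{-H/T} dx` is converted to the probability measure `μ_T` (`OscillatorChain.integral_gibbsMeasure`,
`OscillatorChain.integrable_gibbsMeasure`; `memLp_two_and_integral_sq_le_of_gibbsDensity`).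
References: folklore (Gaussian momenta, one-site domination of the quartic-pinned chain).
-/

noncomputable section

namespace Summit.AtomisticToContinuum.FouriersLaw.Theorems.NoisyFourier.FlipCeiling

open MeasureTheory
open Literature.MathematicalPhysics.KineticTheory.HeatConduction
open Summit.AtomisticToContinuum.FouriersLaw.Theorems.ChainVariation
open Summit.AtomisticToContinuum.FouriersLaw.Theorems.LightConeBondHeat (pinnedChain_integrable_mul_gibbsDensity_of_le_pow)

variable {ω₂ lam β : ℝ}

/-! ### Pointwise domination of the squared half current -/

/-- `(p V'(r))² ≤ 2 p⁴ + r⁴ + β⁴ r¹²` for `V'(r) = r + β r³`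
(`p²(r + βr³)² ≤ 2p²r² + 2β²p²r⁶ ≤ (p⁴ + r⁴) + (p⁴ + β⁴r¹²)`). [folklore] -/
theorem sq_mul_deriv_V_le (γ p r : ℝ) :
    (p * deriv (pinnedChain ω₂ lam β γ).V r) ^ 2 ≤ 2 * p ^ 4 + r ^ 4 + β ^ 4 * r ^ 12 := by
  rw [pinnedChain_deriv_V]
  nlinarith [mul_nonneg (sq_nonneg p) (sq_nonneg (r - β * r ^ 3)), sq_nonneg (p ^ 2 - r ^ 2),
    sq_nonneg (p ^ 2 - β ^ 2 * r ^ 6)]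

/-- `(a - b)^{2m} ≤ 2^{2m-1} (a^{2m} + b^{2m})`. [folklore] -/
theorem sub_pow_even_le (a b : ℝ) (m : ℕ) :
    (a - b) ^ (2 * m) ≤ 2 ^ (2 * m - 1) * (a ^ (2 * m) + b ^ (2 * m)) := by
  have h := (even_two_mul m).add_pow_le (a := a) (b := -b)
  rwa [← sub_eq_add_neg, (even_two_mul m).neg_pow] at h

/-- The squared half current is dominated by one-site monomials:
`(p_k V'(q_j - q_i))² ≤ 2 p_k⁴ + 8 (q_i⁴ + q_j⁴) + 2048 β⁴ (q_i¹² + q_j¹²)`. [folklore] -/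
theorem half_current_sq_le (γ : ℝ) {L : ℕ} (x : PhaseSpace L) (k i j : Fin L) :
    (x.2 k * deriv (pinnedChain ω₂ lam β γ).V (x.1 j - x.1 i)) ^ 2 ≤
      2 * x.2 k ^ (2 * 2) + 8 * (x.1 i ^ (2 * 2) + x.1 j ^ (2 * 2)) +
        2048 * β ^ 4 * (x.1 i ^ (2 * 6) + x.1 j ^ (2 * 6)) := by
  have h0 := sq_mul_deriv_V_le (ω₂ := ω₂) (lam := lam) (β := β) γ (x.2 k) (x.1 j - x.1 i)
  have h4 := sub_pow_even_le (x.1 j) (x.1 i) 2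
  have h12 := sub_pow_even_le (x.1 j) (x.1 i) 6
  norm_num at h4 h12 ⊢
  have hβ4 : 0 ≤ β ^ 4 := by positivity
  nlinarith [mul_le_mul_of_nonneg_left h12 hβ4]

/-! ### Weighted integrals: `N`-uniform one-site moments -/

/-- **Uniform weighted bound.** For the pinned chain (`ω₂ > 0`, `lam, β ≥ 0`, `T > 0`) there is `K(ω₂, lam, β, T)`
with `(p_k V'(q_j - q_i))² e^{-H/T} ∈ L¹(dx)` and `∫ (p_k V'(q_j - q_i))² e^{-H/T} dx ≤ K ∫ e^{-H/T} dx` for EVERY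
length `L` and all sites `k, i, j` (Gaussian fourth momentum moment, one-site position moments of order `4, 12`).
[folklore] -/
theorem exists_integral_half_current_sq_mul_gibbsDensity_le (hω : 0 < ω₂) (hl : 0 ≤ lam) (hβ : 0 ≤ β)
    (γ : ℝ) {T : ℝ} (hT : 0 < T) :
    ∃ K : ℝ, ∀ (L : ℕ) (k i j : Fin L),
      Integrable (fun x : PhaseSpace L => (x.2 k * deriv (pinnedChain ω₂ lam β γ).V (x.1 j - x.1 i)) ^ 2 *
        (pinnedChain ω₂ lam β γ).gibbsDensity L T x) ∧
      ∫ x : PhaseSpace L, (x.2 k * deriv (pinnedChain ω₂ lam β γ).V (x.1 j - x.1 i)) ^ 2 *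
          (pinnedChain ω₂ lam β γ).gibbsDensity L T x ≤
        K * ∫ x : PhaseSpace L, (pinnedChain ω₂ lam β γ).gibbsDensity L T x := by
  set P := pinnedChain ω₂ lam β γ with hP
  -- the one-site moment ratios `κ₄, κ₁₂`
  set κ₄ : ℝ := ((∫⁻ a, ENNReal.ofReal (a ^ (2 * 2)) * ENNReal.ofReal (Real.exp (-P.U a / T))) /
      ∫⁻ a, ENNReal.ofReal (Real.exp (-P.U a / T))).toReal with hκ₄
  set κ₁₂ : ℝ := ((∫⁻ a, ENNReal.ofReal (a ^ (2 * 6)) * ENNReal.ofReal (Real.exp (-P.U a / T))) /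
      ∫⁻ a, ENNReal.ofReal (Real.exp (-P.U a / T))).toReal with hκ₁₂
  refine ⟨2 * (((2 * 2).factorial : ℝ) * T ^ 2) + 8 * (κ₄ + κ₄) + 2048 * β ^ 4 * (κ₁₂ + κ₁₂),
    fun L k i j => ?_⟩
  set ρ : PhaseSpace L → ℝ := P.gibbsDensity L T with hρ
  have hρ0 : ∀ x, 0 ≤ ρ x := fun x => (P.gibbsDensity_pos L T x).le
  have hVc : Continuous (deriv P.V) := by
    have : deriv P.V = fun r => r + β * r ^ 3 := funext fun r => pinnedChain_deriv_V ω₂ lam β γ r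
    rw [this]; fun_prop
  have hfc : Continuous fun x : PhaseSpace L => (x.2 k * deriv P.V (x.1 j - x.1 i)) ^ 2 * ρ x :=
    ((((continuous_apply k).comp continuous_snd).mul (hVc.comp (((continuous_apply j).comp continuous_fst).sub
      ((continuous_apply i).comp continuous_fst)))).pow 2).mul (pinnedChain_continuous_gibbsDensity ω₂ lam β γ L T)
  -- moments
  have hp4 : ∫ x, x.2 k ^ (2 * 2) * ρ x ≤ ((2 * 2).factorial : ℝ) * T ^ 2 * ∫ x, ρ x :=
    pinnedChain_integral_momentum_even_pow_le hω hl hβ γ L hT k 2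
  have hqi4 := pinnedChain_integral_coord_pow_mul_gibbsDensity_le hω hl hβ γ hT L i 2
  have hqj4 := pinnedChain_integral_coord_pow_mul_gibbsDensity_le hω hl hβ γ hT L j 2
  have hqi12 := pinnedChain_integral_coord_pow_mul_gibbsDensity_le hω hl hβ γ hT L i 6
  have hqj12 := pinnedChain_integral_coord_pow_mul_gibbsDensity_le hω hl hβ γ hT L j 6
  rw [← hP] at hqi4 hqj4 hqi12 hqj12
  -- integrability of the monomials
  have hIp : Integrable fun x => x.2 k ^ (2 * 2) * ρ x :=
    pinnedChain_integrable_momentum_pow_mul_gibbsDensity_all hω hl hβ γ L hT k (2 * 2)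
  have hIq : ∀ (s : Fin L) (n : ℕ), Integrable fun x : PhaseSpace L => x.1 s ^ n * ρ x := fun s n =>
    pinnedChain_integrable_mul_gibbsDensity_of_le_pow hω hl hβ γ L hT n
      (((continuous_apply s).comp continuous_fst).pow n) (C := (1 + ω₂⁻¹) ^ n) fun x => by
        rw [abs_pow, ← mul_pow]
        exact pow_le_pow_left₀ (abs_nonneg _) (pinnedChain_abs_coord_le hω hl hβ γ L x s) n
  -- the majorant `g = 2 p_k⁴ ρ + 8 (q_i⁴ + q_j⁴) ρ + 2048 β⁴ (q_i¹² + q_j¹²) ρ`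
  have hI1 : Integrable fun x : PhaseSpace L => 2 * (x.2 k ^ (2 * 2) * ρ x) := hIp.const_mul 2
  have hI2 : Integrable fun x : PhaseSpace L => 8 * (x.1 i ^ (2 * 2) * ρ x + x.1 j ^ (2 * 2) * ρ x) :=
    ((hIq i _).fun_add (hIq j _)).const_mul 8
  have hI3 : Integrable fun x : PhaseSpace L =>
      2048 * β ^ 4 * (x.1 i ^ (2 * 6) * ρ x + x.1 j ^ (2 * 6) * ρ x) :=
    ((hIq i _).fun_add (hIq j _)).const_mul _
  have hIg : Integrable fun x : PhaseSpace L => 2 * (x.2 k ^ (2 * 2) * ρ x) +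
      8 * (x.1 i ^ (2 * 2) * ρ x + x.1 j ^ (2 * 2) * ρ x) +
      2048 * β ^ 4 * (x.1 i ^ (2 * 6) * ρ x + x.1 j ^ (2 * 6) * ρ x) := (hI1.fun_add hI2).fun_add hI3
  have hpt : ∀ x, (x.2 k * deriv P.V (x.1 j - x.1 i)) ^ 2 * ρ x ≤ 2 * (x.2 k ^ (2 * 2) * ρ x) +
      8 * (x.1 i ^ (2 * 2) * ρ x + x.1 j ^ (2 * 2) * ρ x) +
      2048 * β ^ 4 * (x.1 i ^ (2 * 6) * ρ x + x.1 j ^ (2 * 6) * ρ x) := fun x => by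
    have := mul_le_mul_of_nonneg_right (half_current_sq_le (ω₂ := ω₂) (lam := lam) (β := β) γ x k i j) (hρ0 x)
    refine this.trans_eq ?_
    ring
  have hIf : Integrable fun x : PhaseSpace L => (x.2 k * deriv P.V (x.1 j - x.1 i)) ^ 2 * ρ x :=
    hIg.mono' hfc.aestronglyMeasurable (ae_of_all _ fun x => by
      rw [Real.norm_eq_abs, abs_of_nonneg (mul_nonneg (sq_nonneg _) (hρ0 x))]
      exact hpt x)
  refine ⟨hIf, ?_⟩
  have hintg : ∫ x, (2 * (x.2 k ^ (2 * 2) * ρ x) + 8 * (x.1 i ^ (2 * 2) * ρ x + x.1 j ^ (2 * 2) * ρ x) +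
      2048 * β ^ 4 * (x.1 i ^ (2 * 6) * ρ x + x.1 j ^ (2 * 6) * ρ x)) =
      2 * (∫ x, x.2 k ^ (2 * 2) * ρ x) +
        8 * ((∫ x, x.1 i ^ (2 * 2) * ρ x) + ∫ x, x.1 j ^ (2 * 2) * ρ x) +
        2048 * β ^ 4 * ((∫ x, x.1 i ^ (2 * 6) * ρ x) + ∫ x, x.1 j ^ (2 * 6) * ρ x) := by
    rw [integral_add (f := fun x => 2 * (x.2 k ^ (2 * 2) * ρ x) + 8 * (x.1 i ^ (2 * 2) * ρ x + x.1 j ^ (2 * 2) * ρ x))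
        (g := fun x => 2048 * β ^ 4 * (x.1 i ^ (2 * 6) * ρ x + x.1 j ^ (2 * 6) * ρ x)) (hI1.fun_add hI2) hI3,
      integral_add (f := fun x => 2 * (x.2 k ^ (2 * 2) * ρ x))
        (g := fun x => 8 * (x.1 i ^ (2 * 2) * ρ x + x.1 j ^ (2 * 2) * ρ x)) hI1 hI2,
      integral_const_mul, integral_const_mul, integral_const_mul,
      integral_add (f := fun x => x.1 i ^ (2 * 2) * ρ x) (g := fun x => x.1 j ^ (2 * 2) * ρ x) (hIq i _) (hIq j _),
      integral_add (f := fun x => x.1 i ^ (2 * 6) * ρ x) (g := fun x => x.1 j ^ (2 * 6) * ρ x) (hIq i _) (hIq j _)]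
  have h12 : 2048 * β ^ 4 * ((∫ x, x.1 i ^ (2 * 6) * ρ x) + ∫ x, x.1 j ^ (2 * 6) * ρ x) ≤
      2048 * β ^ 4 * (κ₁₂ * (∫ x, ρ x) + κ₁₂ * ∫ x, ρ x) :=
    mul_le_mul_of_nonneg_left (add_le_add hqi12 hqj12) (by positivity)
  have h4 : 8 * ((∫ x, x.1 i ^ (2 * 2) * ρ x) + ∫ x, x.1 j ^ (2 * 2) * ρ x) ≤
      8 * (κ₄ * (∫ x, ρ x) + κ₄ * ∫ x, ρ x) :=
    mul_le_mul_of_nonneg_left (add_le_add hqi4 hqj4) (by norm_num)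
  have h2 : 2 * (∫ x, x.2 k ^ (2 * 2) * ρ x) ≤ 2 * (((2 * 2).factorial : ℝ) * T ^ 2 * ∫ x, ρ x) :=
    mul_le_mul_of_nonneg_left hp4 (by norm_num)
  calc ∫ x, (x.2 k * deriv P.V (x.1 j - x.1 i)) ^ 2 * ρ x
      ≤ ∫ x, (2 * (x.2 k ^ (2 * 2) * ρ x) + 8 * (x.1 i ^ (2 * 2) * ρ x + x.1 j ^ (2 * 2) * ρ x) +
          2048 * β ^ 4 * (x.1 i ^ (2 * 6) * ρ x + x.1 j ^ (2 * 6) * ρ x)) := integral_mono hIf hIg hpt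
    _ = _ := hintg
    _ ≤ 2 * (((2 * 2).factorial : ℝ) * T ^ 2 * ∫ x, ρ x) + 8 * (κ₄ * (∫ x, ρ x) + κ₄ * ∫ x, ρ x) +
          2048 * β ^ 4 * (κ₁₂ * (∫ x, ρ x) + κ₁₂ * ∫ x, ρ x) := add_le_add (add_le_add h2 h4) h12
    _ = _ := by ring

/-! ### From the Gibbs weight to the Gibbs probability measure -/

/-- **Conversion.** If `f` is continuous, `f² e^{-H/T} ∈ L¹(dx)` and `∫ f² e^{-H/T} dx ≤ K ∫ e^{-H/T} dx`, then
`f ∈ L²(μ_T)` and `∫ f² dμ_T ≤ K` for the Gibbs probability measure `μ_T = Z⁻¹ e^{-H/T} dx` of the pinned chain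
(`ω₂ > 0`, `lam, β ≥ 0`, `T > 0`, so `0 < Z < ∞`). [folklore] -/
theorem memLp_two_and_integral_sq_le_of_gibbsDensity (hω : 0 < ω₂) (hl : 0 ≤ lam) (hβ : 0 ≤ β) (γ : ℝ)
    (L : ℕ) {T : ℝ} (hT : 0 < T) {f : PhaseSpace L → ℝ} (hf : Continuous f) {K : ℝ}
    (hI : Integrable fun x => f x ^ 2 * (pinnedChain ω₂ lam β γ).gibbsDensity L T x)
    (hle : ∫ x, f x ^ 2 * (pinnedChain ω₂ lam β γ).gibbsDensity L T x ≤
      K * ∫ x, (pinnedChain ω₂ lam β γ).gibbsDensity L T x) :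
    MemLp f 2 ((pinnedChain ω₂ lam β γ).gibbsMeasure L T) ∧
      ∫ x, f x ^ 2 ∂((pinnedChain ω₂ lam β γ).gibbsMeasure L T) ≤ K := by
  set P := pinnedChain ω₂ lam β γ with hP
  have hρi : Integrable (P.gibbsDensity L T) := pinnedChain_integrable_gibbsDensity hω hl hβ γ L hT
  have hZpos : 0 < ∫ x, P.gibbsDensity L T x := integral_exp_pos hρi
  refine ⟨?_, ?_⟩
  · rw [memLp_two_iff_integrable_sq hf.aestronglyMeasurable]
    exact P.integrable_gibbsMeasure hI
  · rw [P.integral_gibbsMeasure]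
    calc (∫ x, P.gibbsDensity L T x)⁻¹ * ∫ x, f x ^ 2 * P.gibbsDensity L T x
        ≤ (∫ x, P.gibbsDensity L T x)⁻¹ * (K * ∫ x, P.gibbsDensity L T x) :=
          mul_le_mul_of_nonneg_left hle (inv_nonneg.2 hZpos.le)
      _ = K := by field_simp

/-! ### The uniform `L²(μ_T)` bound -/

/-- **Uniform `L²(μ_T)` bound on the half currents.** For the pinned chain (`ω₂ > 0`, `lam, β ≥ 0`, `T > 0`) there
is `M(ω₂, lam, β, T)` such that for EVERY length `L` and all sites `k, i, j`: `p_k V'(q_j - q_i) ∈ L²(μ_T)` and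
`∫ (p_k V'(q_j - q_i))² dμ_T ≤ M`. [folklore] -/
theorem gibbsHalfCurrentSqLe (hω : 0 < ω₂) (hl : 0 ≤ lam) (hβ : 0 ≤ β) (γ : ℝ) {T : ℝ} (hT : 0 < T) :
    ∃ M : ℝ, ∀ (L : ℕ) (k i j : Fin L),
      MemLp (fun x : PhaseSpace L => x.2 k * deriv (pinnedChain ω₂ lam β γ).V (x.1 j - x.1 i)) 2
          ((pinnedChain ω₂ lam β γ).gibbsMeasure L T) ∧
        ∫ x, (x.2 k * deriv (pinnedChain ω₂ lam β γ).V (x.1 j - x.1 i)) ^ 2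
            ∂((pinnedChain ω₂ lam β γ).gibbsMeasure L T) ≤ M := by
  obtain ⟨K, hK⟩ := exists_integral_half_current_sq_mul_gibbsDensity_le hω hl hβ γ hT
  refine ⟨K, fun L k i j => ?_⟩
  have hVc : Continuous (deriv (pinnedChain ω₂ lam β γ).V) := by
    have : deriv (pinnedChain ω₂ lam β γ).V = fun r => r + β * r ^ 3 :=
      funext fun r => pinnedChain_deriv_V ω₂ lam β γ r
    rw [this]; fun_prop
  have hc : Continuous fun x : PhaseSpace L => x.2 k * deriv (pinnedChain ω₂ lam β γ).V (x.1 j - x.1 i) :=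
    ((continuous_apply k).comp continuous_snd).mul (hVc.comp (((continuous_apply j).comp continuous_fst).sub
      ((continuous_apply i).comp continuous_fst)))
  exact memLp_two_and_integral_sq_le_of_gibbsDensity hω hl hβ γ L hT hc (hK L k i j).1 (hK L k i j).2

/-! ## Registered helper -/

/-- Registered helper sub-goal `helper_gibbsHalfCurrentSqLe` of stub `stub_flipConductanceCeiling`
(line `sector-dirichlet-gluing`, crux stmt-AtomisticToContinuum-11977): for the pinned chain `pinnedChain ω₂ lam β γ`
(`ω₂, lam, β, T > 0`, any `γ`) there is `M` such that for every length `L` and every bond `j = i + 1` both halves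
`p_i V'(q_j - q_i)`, `p_j V'(q_j - q_i)` of the bond current are in `L²(μ_T)` with `∫ (·)² dμ_T ≤ M`
(`gibbsHalfCurrentSqLe`, notation-free restatement; the adjacency hypothesis is not used). [folklore] -/
theorem helper_gibbsHalfCurrentSqLe : ∀ (ω₂ lam β γ T : ℝ), 0 < ω₂ → 0 < lam → 0 < β → 0 < T → ∃ M : ℝ, ∀ (L : ℕ) (i j : Fin L), j.val = i.val + 1 → (MeasureTheory.MemLp (fun x : Literature.MathematicalPhysics.KineticTheory.HeatConduction.PhaseSpace L => x.2 i * deriv (Literature.MathematicalPhysics.KineticTheory.HeatConduction.pinnedChain ω₂ lam β γ).V (x.1 j - x.1 i)) 2 ((Literature.MathematicalPhysics.KineticTheory.HeatConduction.pinnedChain ω₂ lam β γ).gibbsMeasure L T) ∧ MeasureTheory.integral ((Literature.MathematicalPhysics.KineticTheory.HeatConduction.pinnedChain ω₂ lam β γ).gibbsMeasure L T) (fun x => (x.2 i * deriv (Literature.MathematicalPhysics.KineticTheory.HeatConduction.pinnedChain ω₂ lam β γ).V (x.1 j - x.1 i)) ^ 2) ≤ M) ∧ (MeasureTheory.MemLp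 (fun x : Literature.MathematicalPhysics.KineticTheory.HeatConduction.PhaseSpace L => x.2 j * deriv (Literature.MathematicalPhysics.KineticTheory.HeatConduction.pinnedChain ω₂ lam β γ).V (x.1 j - x.1 i)) 2 ((Literature.MathematicalPhysics.KineticTheory.HeatConduction.pinnedChain ω₂ lam β γ).gibbsMeasure L T) ∧ MeasureTheory.integral ((Literature.MathematicalPhysics.KineticTheory.HeatConduction.pinnedChain ω₂ lam β γ).gibbsMeasure L T) (fun x => (x.2 j * deriv (Literature.MathematicalPhysics.KineticTheory.HeatConduction.pinnedChain ω₂ lam β γ).V (x.1 j - x.1 i)) ^ 2) ≤ M) := by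
  intro ω₂ lam β γ T hω hl hβ hT
  obtain ⟨M, hM⟩ := gibbsHalfCurrentSqLe hω hl.le hβ.le γ hT
  exact ⟨M, fun L i j _ => ⟨hM L i i j, hM L j i j⟩⟩

end Summit.AtomisticToContinuum.FouriersLaw.Theorems.NoisyFourier.FlipCeiling

end
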